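import Mathlib
import HarnessLib
import Summits.HubbardSuperconductivity.HubbardSuperconductivity.Theorems.ComplexGFFStiffnessF4l2BlockB2
import Summits.HubbardSuperconductivity.HubbardSuperconductivity.Theorems.ComplexGFFStiffnessF4l2BlockB1Excess
import Summits.HubbardSuperconductivity.HubbardSuperconductivity.Theorems.ComplexGFFStiffnessF4l2BlockB1Parallelogram

/-!
# Crux child `TwoKernelSkBound` (stmt-HubbardSuperconductivity-27414), line `banach_two_kernel`, stub `stub_f4l2ShrinkLoc` —
# the four-corner ASSEMBLY at kernel level: second `q`-differences of `K_{k+1}` modulo the kernel parallelogram B4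

Route `route-HubbardSuperconductivity-ComplexGFFStiffness`; memo `Cruxes/HypACumulant/TWOKERNEL-PLAN-27414-v3.md` §0 (the split
`S₁₁ − S₁₀ − S₀₁ + S₀₀ = B1 + B2 + B3 + B4`, `S_ρ = nextKStep D_ρ (toHam u) (mulExt v) = G_ρ(H̃_ρ)` by `rfl`).  Blocks B1 (excess p833412 +
parallelogram), B2 (p833227) and B3 (B2 with `y ↔ z`) are landed for every package with `0 < P.r`; this file adds them up: **given the
kernel parallelogram B4 at the fixed intermediate Hamiltonian `H̃_q` (hypothesis `hB4`, the `ℓ = 2` kernel-only twins — memo §2 R4), the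
mixed second `q`-difference of the RAW step map has weak norm `≤ l·|y|₁|z|₁·max(‖u‖,c_v)` with `N`-free `l, T₂`**
(`exists_weakNormLE_secondDiff_nextKStep_of_blockB4`).  What then remains for the registered stub is B4 itself and the `opS`/`P.shrink`
plumbing (pattern `ComplexGFFStiffnessTwoKernelSkBoundRawReduction`).  All proved, no `sorry`.  Honest scope: rung route (stiffness of a
complex Gaussian gradient field via the [ABKM19] RG); nothing about superconductivity in the Hubbard model.

## References
* S. Adams, S. Buchholz, R. Kotecký, S. Müller, arXiv:1910.13564, Definition 6.5 (6.34), Theorem 6.8, Lemma 12.6 (12.53)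
  [AdamsBuchholzKoteckyMuller2019].
-/

noncomputable section

-- `Summit.<Summit>.<Problem>`: single-conjunct summit, the duplicate component is mandated (D-0017).
set_option linter.dupNamespace false

namespace Summit.HubbardSuperconductivity.HubbardSuperconductivity.Theorems.ComplexGFF

open MeasureTheory Metric Set
open scoped BigOperators
open Literature.MathematicalPhysics.StatisticalMechanics.GradientRG
open Literature.MathematicalPhysics.StatisticalMechanics.TorusPolymer (IsPolymer blockOf reblock)
open Literature.Barriers.CriticalPhenomena.LongRangePhi4.Polymer (IsConn)
open Literature.MathematicalPhysics.StatisticalMechanics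

variable {d : ℕ}

set_option maxHeartbeats 3200000 in
/-- **Second `q`-differences of `K_{k+1}` modulo the kernel parallelogram B4** (module docstring).
[cite: AdamsBuchholzKoteckyMuller2019, Lemma 12.6 (12.53) / Definition 6.5 (6.34)] -/
theorem exists_weakNormLE_secondDiff_nextKStep_of_blockB4 (P : PackageData d) [Fact (0 < P.h)] [Fact (0 < P.L)] (hr0 : 0 < P.r)
    (hB4 : ∃ l₄ T₂ : ℝ, 0 ≤ l₄ ∧ 0 < T₂ ∧ ∀ (N M : ℕ) [NeZero M] (Q : PackageAt P N M),
      ∀ q y z : Matrix (Fin d) (Fin d) ℝ, P.InBall q → P.InBall (q + y) → P.InBall (q + z) → P.InBall (q + y + z) →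
      esum y ≤ T₂ → esum z ≤ T₂ → ∀ k, k + 1 ≤ N →
      ∀ (u : HamSpace ℂ d (fieldWt P.h (P.L : ℝ) d k) ((P.L : ℝ) ^ k) (P.L ^ (d * k)))
        (v : activitySpace Q.normParams k) (cv : ℝ), ‖u‖ ≤ P.r →
        activityNormLE Q.normParams k v cv → cv ≤ P.r →
      WeakNormLE Q.normParams (k + 1)
        (fun X ψ =>
          nextK (abkmStepData P.L P.R k (Q.kernels (q + y + z))).s
              (reblock (abkmStepData P.L P.R k (Q.kernels (q + y + z))).s
                ((abkmStepData P.L P.R k (Q.kernels (q + y + z))).L * (abkmStepData P.L P.R k (Q.kernels (q + y + z))).s))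
              (stepMeasure (abkmStepData P.L P.R k (Q.kernels (q + y + z))).𝒞) (expNegH (HamSpace.toHam u))
              (expNegH (nextH (abkmStepData P.L P.R k (Q.kernels q)) (HamSpace.toHam u)
                (mulExt ((v : activitySpace Q.normParams k) : Finset (Fin d → ZMod M) → ((Fin d → ZMod M) → ℝ) → ℂ))))
              (mulExt ((v : activitySpace Q.normParams k) : Finset (Fin d → ZMod M) → ((Fin d → ZMod M) → ℝ) → ℂ)) X ψ -
          nextK (abkmStepData P.L P.R k (Q.kernels (q + y))).s
              (reblock (abkmStepData P.L P.R k (Q.kernels (q + y))).s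
                ((abkmStepData P.L P.R k (Q.kernels (q + y))).L * (abkmStepData P.L P.R k (Q.kernels (q + y))).s))
              (stepMeasure (abkmStepData P.L P.R k (Q.kernels (q + y))).𝒞) (expNegH (HamSpace.toHam u))
              (expNegH (nextH (abkmStepData P.L P.R k (Q.kernels q)) (HamSpace.toHam u)
                (mulExt ((v : activitySpace Q.normParams k) : Finset (Fin d → ZMod M) → ((Fin d → ZMod M) → ℝ) → ℂ))))
              (mulExt ((v : activitySpace Q.normParams k) : Finset (Fin d → ZMod M) → ((Fin d → ZMod M) → ℝ) → ℂ)) X ψ -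
          nextK (abkmStepData P.L P.R k (Q.kernels (q + z))).s
              (reblock (abkmStepData P.L P.R k (Q.kernels (q + z))).s
                ((abkmStepData P.L P.R k (Q.kernels (q + z))).L * (abkmStepData P.L P.R k (Q.kernels (q + z))).s))
              (stepMeasure (abkmStepData P.L P.R k (Q.kernels (q + z))).𝒞) (expNegH (HamSpace.toHam u))
              (expNegH (nextH (abkmStepData P.L P.R k (Q.kernels q)) (HamSpace.toHam u)
                (mulExt ((v : activitySpace Q.normParams k) : Finset (Fin d → ZMod M) → ((Fin d → ZMod M) → ℝ) → ℂ))))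
              (mulExt ((v : activitySpace Q.normParams k) : Finset (Fin d → ZMod M) → ((Fin d → ZMod M) → ℝ) → ℂ)) X ψ +
          nextK (abkmStepData P.L P.R k (Q.kernels q)).s
              (reblock (abkmStepData P.L P.R k (Q.kernels q)).s
                ((abkmStepData P.L P.R k (Q.kernels q)).L * (abkmStepData P.L P.R k (Q.kernels q)).s))
              (stepMeasure (abkmStepData P.L P.R k (Q.kernels q)).𝒞) (expNegH (HamSpace.toHam u))
              (expNegH (nextH (abkmStepData P.L P.R k (Q.kernels q)) (HamSpace.toHam u)
                (mulExt ((v : activitySpace Q.normParams k) : Finset (Fin d → ZMod M) → ((Fin d → ZMod M) → ℝ) → ℂ))))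
              (mulExt ((v : activitySpace Q.normParams k) : Finset (Fin d → ZMod M) → ((Fin d → ZMod M) → ℝ) → ℂ)) X ψ)
        (l₄ * esum y * esum z * max ‖u‖ cv)) :
    ∃ l T₂ : ℝ, 0 ≤ l ∧ 0 < T₂ ∧ ∀ (N M : ℕ) [NeZero M] (Q : PackageAt P N M),
      ∀ q y z : Matrix (Fin d) (Fin d) ℝ, P.InBall q → P.InBall (q + y) → P.InBall (q + z) → P.InBall (q + y + z) →
      esum y ≤ T₂ → esum z ≤ T₂ → ∀ k, k + 1 ≤ N →
      ∀ (u : HamSpace ℂ d (fieldWt P.h (P.L : ℝ) d k) ((P.L : ℝ) ^ k) (P.L ^ (d * k)))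
        (v : activitySpace Q.normParams k) (cv : ℝ), ‖u‖ ≤ P.r →
        activityNormLE Q.normParams k v cv → cv ≤ P.r →
      WeakNormLE Q.normParams (k + 1)
        (fun X ψ =>
          nextKStep (abkmStepData P.L P.R k (Q.kernels (q + y + z))) (HamSpace.toHam u)
              (mulExt ((v : activitySpace Q.normParams k) : Finset (Fin d → ZMod M) → ((Fin d → ZMod M) → ℝ) → ℂ)) X ψ -
          nextKStep (abkmStepData P.L P.R k (Q.kernels (q + y))) (HamSpace.toHam u)
              (mulExt ((v : activitySpace Q.normParams k) : Finset (Fin d → ZMod M) → ((Fin d → ZMod M) → ℝ) → ℂ)) X ψ -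
          nextKStep (abkmStepData P.L P.R k (Q.kernels (q + z))) (HamSpace.toHam u)
              (mulExt ((v : activitySpace Q.normParams k) : Finset (Fin d → ZMod M) → ((Fin d → ZMod M) → ℝ) → ℂ)) X ψ +
          nextKStep (abkmStepData P.L P.R k (Q.kernels q)) (HamSpace.toHam u)
              (mulExt ((v : activitySpace Q.normParams k) : Finset (Fin d → ZMod M) → ((Fin d → ZMod M) → ℝ) → ℂ)) X ψ)
        (l * esum y * esum z * max ‖u‖ cv) := by
  obtain ⟨l₄, T₄, hl₄, hT₄, h4⟩ := hB4
  obtain ⟨l₁, T₁, hl₁, hT₁, h1⟩ := exists_weakNormLE_blockB1_excess P hr0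
  obtain ⟨l₁', T₁', hl₁', hT₁', h1'⟩ := exists_weakNormLE_blockB1_parallelogram P hr0
  obtain ⟨l₂, T₂', hl₂, hT₂', h2⟩ := exists_weakNormLE_blockB2 P hr0
  refine ⟨l₁ + l₁' + l₂ + l₂ + l₄, min (min T₁ T₁') (min T₂' T₄), by positivity, by positivity, fun N M _ Q => ?_⟩
  intro q y z hq hqy hqz hqyz hy hz k hk u v cv hu hv hcv
  have hy1 : esum y ≤ T₁ := hy.trans ((min_le_left _ _).trans (min_le_left _ _))
  have hz1 : esum z ≤ T₁ := hz.trans ((min_le_left _ _).trans (min_le_left _ _))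
  have hy1' : esum y ≤ T₁' := hy.trans ((min_le_left _ _).trans (min_le_right _ _))
  have hz1' : esum z ≤ T₁' := hz.trans ((min_le_left _ _).trans (min_le_right _ _))
  have hy2 : esum y ≤ T₂' := hy.trans ((min_le_right _ _).trans (min_le_left _ _))
  have hz2 : esum z ≤ T₂' := hz.trans ((min_le_right _ _).trans (min_le_left _ _))
  have hy4 : esum y ≤ T₄ := hy.trans ((min_le_right _ _).trans (min_le_right _ _))
  have hz4 : esum z ≤ T₄ := hz.trans ((min_le_right _ _).trans (min_le_right _ _))
  have hqzy : P.InBall (q + z + y) := by rw [add_right_comm]; exact hqyz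
  -- the five blocks
  have hA := h1 N M Q q y z hq hqy hqz hqyz hy1 hz1 k hk u v cv hu hv hcv
  have hB := h1' N M Q q y z hq hqy hqz hqyz hy1' hz1' k hk u v cv hu hv hcv
  have hC := h2 N M Q q y z hq hqy hqyz hy2 hz2 k hk u v cv hu hv hcv
  have hD := h2 N M Q q z y hq hqz hqzy hz2 hy2 k hk u v cv hu hv hcv
  rw [add_right_comm q z y] at hD
  have hE := h4 N M Q q y z hq hqy hqz hqyz hy4 hz4 k hk u v cv hu hv hcv
  -- smoothness of the pieces
  have hPA : 0 < Q.normParams.A := P.A_pos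
  have hk1 : 1 ≤ P.L ^ k := Nat.one_le_pow _ _ P.hLodd.pos
  have hMt : M = Q.normParams.L ^ k * P.L ^ (N - k) := by
    show M = P.L ^ k * P.L ^ (N - k)
    rw [Q.hM, ← pow_add, Nat.add_sub_cancel' (by omega)]
  have hcv0 : 0 ≤ cv := nonneg_of_weakNormLE hPA hMt P.hLodd.pow P.hLodd.pow hv
  have hH8 : hamNorm (fieldWt P.h (P.L : ℝ) d k) ((P.L : ℝ) ^ k) (P.L ^ (d * k)) (HamSpace.toHam u) ≤ 1 / 8 := by
    rw [← HamSpace.norm_def]; exact hu.trans (P.hr.trans (by norm_num))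
  have hKr : WeakNormLE Q.normParams k (mulExt ((v : activitySpace Q.normParams k) : Finset (Fin d → ZMod M) → ((Fin d → ZMod M) → ℝ) → ℂ)) cv := activitySpace.weakNormLE_mulExt v hv
  have hKd : ∀ Y, ContDiff ℝ P.r₀ ((mulExt ((v : activitySpace Q.normParams k) : Finset (Fin d → ZMod M) → ((Fin d → ZMod M) → ℝ) → ℂ)) Y) := activitySpace.contDiff_mulExt v
  have hKloc : ∀ Y, IsPolymer (P.L ^ k) Y → IsConn Y → IsGaugeLocal (Q.normParams.gauge k Y) ((mulExt ((v : activitySpace Q.normParams k) : Finset (Fin d → ZMod M) → ((Fin d → ZMod M) → ℝ) → ℂ)) Y) :=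
    fun Y hY hYc => activitySpace.isGaugeLocal_mulExt v hY hYc
  have hcd : ∀ {qq : Matrix (Fin d) (Fin d) ℝ}, P.InBall qq → ∀ (Ht : RelevantHamiltonian ℂ d) (X : Finset (Fin d → ZMod M)),
      ContDiff ℝ Q.normParams.r₀ (nextK (abkmStepData P.L P.R k (Q.kernels qq)).s
        (reblock (abkmStepData P.L P.R k (Q.kernels qq)).s
          ((abkmStepData P.L P.R k (Q.kernels qq)).L * (abkmStepData P.L P.R k (Q.kernels qq)).s))
        (stepMeasure (abkmStepData P.L P.R k (Q.kernels qq)).𝒞) (expNegH (HamSpace.toHam u)) (expNegH Ht)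
        (mulExt ((v : activitySpace Q.normParams k) : Finset (Fin d → ZMod M) → ((Fin d → ZMod M) → ℝ) → ℂ)) X) := by
    intro qq hqq Ht X
    exact contDiff_nextK_freeHt_abkm_of_stepKernelBounds P.hd P.hLodd P.hL Q.hM hk P.hp P.hpM P.hMR Q.hB P.hδ₀ P.hδ₁
      P.hh P.hh0 P.hA1 (abkmStepData P.L P.R k (Q.kernels qq)) rfl rfl (packageAt_stepKernelBounds P Q hqq hk) (x₀ := 0) rfl rfl
      hH8 Ht hcv0 hKr (factorises_mulExt hk1) (fun φ => mulExt_empty φ) hKd hKloc X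
  -- add the five bounds polymer by polymer
  intro X hX hXc
  have tA := hA X hX hXc
  have tB := hB X hX hXc
  have tC := hC X hX hXc
  have tD := hD X hX hXc
  have tE := hE X hX hXc
  have s1 := tA.add tB (((hcd hqyz _ X).sub (hcd hqyz _ X))) ((((hcd hqyz _ X).sub (hcd hqyz _ X)).sub (hcd hqyz _ X)).add (hcd hqyz _ X))
  have s2 := s1.add tC ((((hcd hqyz _ X).sub (hcd hqyz _ X))).add ((((hcd hqyz _ X).sub (hcd hqyz _ X)).sub (hcd hqyz _ X)).add (hcd hqyz _ X)))
    (((hcd hqyz _ X).sub (hcd hqy _ X)).sub ((hcd hqyz _ X).sub (hcd hqy _ X)))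
  have s3 := s2.add tD (((((hcd hqyz _ X).sub (hcd hqyz _ X))).add ((((hcd hqyz _ X).sub (hcd hqyz _ X)).sub (hcd hqyz _ X)).add (hcd hqyz _ X))).add
    (((hcd hqyz _ X).sub (hcd hqy _ X)).sub ((hcd hqyz _ X).sub (hcd hqy _ X))))
    (((hcd hqyz _ X).sub (hcd hqz _ X)).sub ((hcd hqyz _ X).sub (hcd hqz _ X)))
  have s4 := s3.add tE ((((((hcd hqyz _ X).sub (hcd hqyz _ X))).add ((((hcd hqyz _ X).sub (hcd hqyz _ X)).sub (hcd hqyz _ X)).add (hcd hqyz _ X))).add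
    (((hcd hqyz _ X).sub (hcd hqy _ X)).sub ((hcd hqyz _ X).sub (hcd hqy _ X)))).add
    (((hcd hqyz _ X).sub (hcd hqz _ X)).sub ((hcd hqyz _ X).sub (hcd hqz _ X))))
    ((((hcd hqyz _ X).sub (hcd hqy _ X)).sub (hcd hqz _ X)).add (hcd hq _ X))
  -- the four-corner identity (`nextKStep D H K = nextK … (expNegH (nextH D H K)) …` by `rfl`) and the constant
  convert s4 using 1
  all_goals first
    | (funext ψ
       simp only [Pi.add_apply]
       unfold nextKStep
       ring)
    | ring

end Summit.HubbardSuperconductivity.HubbardSuperconductivity.Theorems.ComplexGFF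

end
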